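import Literature.NumberTheory.EllipticCurves.Rank1Residual.Typed.Basic
import HarnessLib

/-!
# Kurihara–Otsuki 2006, Thm. 0.1 (2): at a good supersingular `2` with `a₂ = ±2` and
# `ord₂(L(E,1)/Ω_E) = ord₂ Tam(E) = 0`, the `2^∞`-Selmer group of `E/ℚ` is trivial (named fact)

Topic `NumberTheory/EllipticCurves` (namespace = path). ONE NAMED FACT (D-0014: a PUBLISHED
theorem, statement only, `def … : Prop`, nothing asserted; users take it as a hypothesis; net debt
+1), transcribing a clause of M. Kurihara, R. Otsuki, *On the growth of Selmer groups of an elliptic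
curve with supersingular reduction in the `ℤ₂`-extension of `ℚ`*, Pure Appl. Math. Q. **2** (2006),
no. 2 (Coates special issue), 557–568 [KuriharaOtsuki2006] — the one printed CLASS-LEVEL theorem on
Selmer groups at a supersingular prime `p = 2` (Kobayashi 2003, B. D. Kim 2013, Sprung 2012 §7,
Kitajima–Otsuki 2018 all print "`p` odd"). Filed for the BSD cell `bsd-2adic` (crux
`SupersingularRankZeroAtTwo` of route `ByReductionTypeAtTwo`; consumer
`Summits/…/Theorems/ByReductionTypeAtTwoSupersingularKuriharaOtsuki.lean`).

## Source, read at the page [corpus: paper:doi-10-4310-pamq-2006-v2-n2-a8 p0001–p0003, p0005, p0007–p0008]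

p. 558: "**Theorem 0.1.** Let `E` be an elliptic curve defined over `ℚ` with supersingular
reduction at `2`, and `L(E, s)` be the `L`-function of `E`. We assume that `a₂ ≠ 0`, namely
`a₂ = ±2`, and `ord₂(L(E,1)/Ω_E) = ord₂(Tam(E)) = 0` where `ord₂ : ℚ^× → ℤ` is the normalized
additive valuation at `2`. Then, (1) … the Pontrjagin dual `Sel(E/ℚ_n)^∨` of the Selmer group over
`ℚ_n` of `E[2^∞]` is isomorphic to `ℤ₂[Gal(ℚ_n/ℚ)]/(θ_{ℚ_n}, ν(θ_{ℚ_{n−1}}))` … (2) … Then, we have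
`Sel(E/ℚ) = 0`, `Sel(E/ℚ_n) ≃ ℚ₂/ℤ₂` for `n = 1, 2` as an abelian group, and
`Sel(E/ℚ_n) ≃ ℚ₂/ℤ₂ ⊕ (ℤ/2^{n−2})^{q₃−q₂} ⊕ ⋯` for all `n ≥ 3`. … (3) `Sel(E/ℚ_∞)^∨ ≃ ℤ₂[[Gal(ℚ_∞/ℚ)]]`."
Conventions: p. 557 "we suppose `p = 2` and `E` has good supersingular reduction at `2`",
"`Tam(E) = Πc_ℓ = Π(E(ℚ_ℓ) : E⁰(ℚ_ℓ))`", "`2 ∤ L(E,1)/Ω_E` (where `Ω_E` is the Néron period)";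
p. 561 "`Ω_E = 2 min{Re ω > 0 | ω ∈ Λ_E}` … In this paper, we consider only real periods" — i.e.
`Ω_E = ∫_{E(ℝ)} |ω|` (`= 2ω₁` for a rectangular period lattice, `= ω₁` otherwise); §2.1 p. 563:
"`Sel(E/F) = Ker(H¹(F, E[2^∞]) → ∏_v H¹(F_v, E[2^∞])/(E(F_v) ⊗ ℚ₂/ℤ₂))` where `v` ranges over all
primes of `F`". Proof in the source (§2.2): Kato's zeta elements for `p = 2` over the cyclotomic
`ℤ₂`-extension ("the proofs of [Kato] Theorem 12.4 (3) and Theorem 12.5 (4) can be applied to our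
case even for `p = 2`"), the Euler-system argument `Sel₀(E/ℚ) = 0`, and Lemma 2.1.

## Transcription

* `W/ℚ` elliptic and globally minimal (`[W.IsElliptic] [W.IsGloballyMinimal]`, so that
  `W.frobeniusTrace 2 = a₂`, `W.HasGoodReductionAtPrime 2`, `W.realPeriodRat = ∫_{E(ℝ)}|ω| = Ω_E`,
  `W.tamagawaProduct = Tam(E)` are those of `E`);
* "supersingular reduction at `2`, `a₂ = ±2`" = `W.HasGoodReductionAtPrime 2 ∧
  (W.frobeniusTrace 2 = 2 ∨ W.frobeniusTrace 2 = -2)`;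
* "`ord₂(L(E,1)/Ω_E) = 0`" = `∃ t : ℚ, L(E,1)/Ω_E = t ∧ t ≠ 0 ∧ padicValRat 2 t = 0` (the source's
  `ord₂` lives on `ℚ^×`; `L(E,1) = W.entireLFunction 1`);
* "`ord₂ Tam(E) = 0`" = `¬ 2 ∣ W.tamagawaProduct`;
* "`Sel(E/ℚ) = 0`" = the tree's `2^∞`-Selmer group `W.selmerGroupPInfty 2 ⊆ H¹(ℚ, E[2^∞])` (local
  conditions at every place, finite and infinite — `Selmer.lean`) is finite of order `1`.

Only the clause `Sel(E/ℚ) = 0` of (2) is transcribed. NOT transcribed — TODO(general form): the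
`ℤ₂[Gal(ℚ_n/ℚ)]`-module structure (1), the abelian-group structure of `Sel(E/ℚ_n)` for `n ≥ 1` in
(2), and (3) `Sel(E/ℚ_∞)^∨ ≃ Λ` (the tree does not count points of `Sel` over the layers `ℚ_n`).

References: [KuriharaOtsuki2006] Thm. 0.1, §1.2, §2.1–2.2; [Kato2004Asterisque] Thm. 12.4, 12.5;
[GreenbergLNM1716] §2 (Selmer groups).
-/

noncomputable section

open WeierstrassCurve

namespace Literature.NumberTheory.EllipticCurves

/-- **Kurihara–Otsuki 2006, Theorem 0.1 (2), the clause `Sel(E/ℚ) = 0`.** "Let `E` be an elliptic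
curve defined over `ℚ` with supersingular reduction at `2` … We assume that `a₂ ≠ 0`, namely
`a₂ = ±2`, and `ord₂(L(E,1)/Ω_E) = ord₂(Tam(E)) = 0` … Then … (2) … we have `Sel(E/ℚ) = 0`." In the
tree's spelling: for `W/ℚ` elliptic and globally minimal with good reduction at `2` and
`a₂ = W.frobeniusTrace 2 ∈ {2, −2}`, if `L(E,1)/Ω_E = t ∈ ℚ` with `t ≠ 0` and `ord₂ t = 0`
(`Ω_E = ∫_{E(ℝ)}|ω| = W.realPeriodRat`, the source's Néron period `2 min{Re ω > 0}`) and
`2 ∤ Tam(E) = W.tamagawaProduct`, then `Sel_{2^∞}(E/ℚ) = W.selmerGroupPInfty 2` is finite of order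
`1`. Statement only; nothing asserted; the structure statements (1), (3) and the rest of (2) are
not transcribed. [cite: KuriharaOtsuki2006, Thm. 0.1 (2) (p. 558; conventions pp. 557, 561, 563)] -/
def kuriharaOtsuki_selmer_trivial_supersingular_two : Prop :=
  ∀ (W : WeierstrassCurve ℚ) [W.IsElliptic] [W.IsGloballyMinimal],
    W.HasGoodReductionAtPrime 2 → (W.frobeniusTrace 2 = 2 ∨ W.frobeniusTrace 2 = -2) →
    (∃ t : ℚ, W.entireLFunction 1 / (W.realPeriodRat : ℂ) = (t : ℂ) ∧ t ≠ 0 ∧ padicValRat 2 t = 0) →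
    ¬ 2 ∣ W.tamagawaProduct →
    Finite (W.selmerGroupPInfty 2) ∧ Nat.card (W.selmerGroupPInfty 2) = 1

end Literature.NumberTheory.EllipticCurves

end
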